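import Summits.CriticalPhenomena.CardyFormulaZ2.Theorems.CardyMagicRigidityPinchResamplingDefs
import HarnessLib

/-!
# Blind loop universality as couplings (stub S4 of line `pinch-resampling`, brick B1, hypothesis side)

Crux `Summit.CriticalPhenomena.CardyFormulaZ2.Theses.CardyMagicRigidity.NestingRigidity`
(stmt-CriticalPhenomena-4835), line `pinch-resampling` v2, registered stub
`stub_tomographicTransfer : FourArmCouplingT → FourArmCouplingZ2 → LoopLimitZ2Blind → LoopLimitZ2EqT`.
Companion of `…NestingRigidityCouplingPlumbing` (target side `LoopLimitZ2EqT`) for the HYPOTHESIS `LoopLimitZ2Blind` of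
the Defs module `Theorems/CardyMagicRigidityPinchResamplingDefs.lean`: by `loopLimitZ2Blind_iff` (`Iff.rfl`) it is the
convergence to `0`, as `δ → 0⁺`, of the blind coupling distance `LoopConfig.blindLawEDist`
(`Literature/…/LoopConfigurationsBlind`) between the law of `bondLoopConfig δ 0` under critical bond percolation on `ℤ²`
and the law of `siteLoopConfig δ` under critical site percolation on `𝕋`; hence it is EQUIVALENT to: for every `ε > 0` and
all small meshes `δ > 0` there is a coupling `P` of the two critical measures with
`P[¬ IsBlindClose ε (bondLoopConfig δ 0) (siteLoopConfig δ)] < ε` (`couplings_of_loopLimitZ2Blind`, registered anchor,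
via `exists_coupling_of_blindLawEDist_lt`; converse `loopLimitZ2Blind_of_couplings` via `blindLawEDist_le_of_coupling`;
`loopLimitZ2Blind_iff_couplings`).  Together with `loopLimitZ2EqT_of_tendsto_blindLawEDist_of_improvement` of the
companion file this REDUCES the stub to a coupling-improvement statement at fixed `(η, ε, δ)`.  Pure plumbing
(`ENNReal.tendsto_nhds_zero`); see the audit `S4-audit.md` (item evidence) for the mechanism.
-/

noncomputable section

namespace Summit.CriticalPhenomena.CardyFormulaZ2.Cruxes.NestingRigidity.PinchResampling

open Summit.CriticalPhenomena.CardyFormulaZ2.Theses.CardyMagicRigidity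
open MeasureTheory Filter Literature.Probability.Percolation Literature.Probability.LatticeModels
  Literature.Probability.RandomPlanarGeometry
open scoped ENNReal Topology

/-- **B1, hypothesis side (registered helper anchor).**  Blind loop universality `LoopLimitZ2Blind` supplies, for every
blind precision `ε > 0` and all small meshes `δ > 0`, a coupling `P` of the two critical percolation measures under which
`bondLoopConfig δ 0` and `siteLoopConfig δ` fail to be blind-close at precision `ε` (`LoopConfig.IsBlindClose`:
Hausdorff-close traces and equal winding interiors off the `ε`-collar, type by type, in the window `B(0, 1/ε)`) with
probability `< ε`: eventually `blindLawEDist ≤ ofReal (ε/2) < ofReal ε`, then `exists_coupling_of_blindLawEDist_lt`. -/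
theorem couplings_of_loopLimitZ2Blind : LoopLimitZ2Blind → ∀ ε : ℝ, 0 < ε → ∀ᶠ δ in nhdsWithin (0:ℝ) (Set.Ioi 0), ∃ P : Measure (BondConfig (Site 2) × SiteConfig (Site 2)), P.map Prod.fst = bondPercolation (zdGraph 2) half ∧ P.map Prod.snd = triSitePercolation half ∧ P {p | ¬ LoopConfig.IsBlindClose ε (bondLoopConfig δ 0 p.1) (siteLoopConfig δ p.2)} < ENNReal.ofReal ε := by
  intro h ε hε
  rw [loopLimitZ2Blind_iff, ENNReal.tendsto_nhds_zero] at h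
  filter_upwards [h (ENNReal.ofReal (ε / 2)) (ENNReal.ofReal_pos.2 (half_pos hε))] with δ hδ
  exact LoopConfig.exists_coupling_of_blindLawEDist_lt
    (hδ.trans_lt (ENNReal.ofReal_lt_ofReal_iff'.2 ⟨half_lt_self hε, hε⟩))

/-- Converse of `couplings_of_loopLimitZ2Blind`: such couplings give `LoopLimitZ2Blind` (`blindLawEDist_le_of_coupling`;
every positive extended real dominates some `ofReal ε`, `ε > 0`). -/
theorem loopLimitZ2Blind_of_couplings
    (h : ∀ ε : ℝ, 0 < ε → ∀ᶠ δ in nhdsWithin (0:ℝ) (Set.Ioi 0),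
      ∃ P : Measure (BondConfig (Site 2) × SiteConfig (Site 2)),
        P.map Prod.fst = bondPercolation (zdGraph 2) half ∧ P.map Prod.snd = triSitePercolation half ∧
        P {p | ¬ LoopConfig.IsBlindClose ε (bondLoopConfig δ 0 p.1) (siteLoopConfig δ p.2)} < ENNReal.ofReal ε) :
    LoopLimitZ2Blind := by
  rw [loopLimitZ2Blind_iff, ENNReal.tendsto_nhds_zero]
  intro e he
  rcases eq_or_ne e ⊤ with rfl | hne
  · exact Eventually.of_forall fun δ ↦ le_top
  · have hpos : 0 < e.toReal := ENNReal.toReal_pos he.ne' hne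
    filter_upwards [h e.toReal hpos] with δ hδ
    obtain ⟨P, h₁, h₂, hP⟩ := hδ
    rw [← ENNReal.ofReal_toReal hne]
    exact LoopConfig.blindLawEDist_le_of_coupling hpos P h₁ h₂ hP

/-- `LoopLimitZ2Blind` is EQUIVALENT to the coupling statement of `couplings_of_loopLimitZ2Blind`. -/
theorem loopLimitZ2Blind_iff_couplings :
    LoopLimitZ2Blind ↔ ∀ ε : ℝ, 0 < ε → ∀ᶠ δ in nhdsWithin (0:ℝ) (Set.Ioi 0),
      ∃ P : Measure (BondConfig (Site 2) × SiteConfig (Site 2)),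
        P.map Prod.fst = bondPercolation (zdGraph 2) half ∧ P.map Prod.snd = triSitePercolation half ∧
        P {p | ¬ LoopConfig.IsBlindClose ε (bondLoopConfig δ 0 p.1) (siteLoopConfig δ p.2)} < ENNReal.ofReal ε :=
  ⟨couplings_of_loopLimitZ2Blind, loopLimitZ2Blind_of_couplings⟩

/-- The blind hypothesis in the Literature form consumed by `loopLimitZ2EqT_of_tendsto_blindLawEDist_of_improvement` of the
companion file `…NestingRigidityCouplingPlumbing` (so that the two files compose into
`LoopLimitZ2Blind → (coupling improvement) → LoopLimitZ2EqT` without further glue). -/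
theorem tendsto_blindLawEDist_of_loopLimitZ2Blind (h : LoopLimitZ2Blind) :
    Tendsto (fun δ : ℝ ↦ LoopConfig.blindLawEDist (bondPercolation (zdGraph 2) half) (bondLoopConfig δ 0)
      (triSitePercolation half) (siteLoopConfig δ)) (nhdsWithin 0 (Set.Ioi 0)) (𝓝 0) :=
  loopLimitZ2Blind_iff.1 h

end Summit.CriticalPhenomena.CardyFormulaZ2.Cruxes.NestingRigidity.PinchResampling

end
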